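import Summits.BirchSwinnertonDyer.BirchSwinnertonDyer.Theses.PrintX8
import Summits.BirchSwinnertonDyer.BirchSwinnertonDyer.Theorems.PrintX8SharpFlatRankZeroRoad
import Literature.NumberTheory.EllipticCurves.BurungaleKobayashiOta2024.RankOnePPartOfSharpFlatMainConjecture
import HarnessLib

/-!
# Route `PrintX8` (rev 4) — the three PROVABLE-NOW glue items of seat p1: `GlueRankOneLinkX8`
# (stmt-BirchSwinnertonDyer-20408), `GlueRankZeroLinkX8` (stmt-BirchSwinnertonDyer-20409) and
# `PublishedInputsX8OfParts` (stmt-BirchSwinnertonDyer-20416) (cell `bsd-print-x8`, seat p1 «Sprung 2024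
# BY NAME: acquire, type, discharge»)

PARTITION (D-0054(2)): corner X8 = K3 row A8 = W-ALL row 8 `WAllCornerX8`; proves the route's two
PRINT-LINK glues (published inputs by name + GZK ⟹ C2, C3) and the anonymous-constructor glue of the
held inputs; closes those three SUPPORT items; 0 census cells move (the leaf stays typed modulo the
named residuals K1 = stmt-19875 and `SharpFlatMainConjectureSmallImageX8` = stmt-20402); BSD is not
proved by any of this. Beyond-print theorem: NO.

* `glueRankOneLinkX8_holds : GlueRankOneLinkX8` (`PublishedInputsX8 → RankEqAnalyticRankLeOne →
  SharpFlatRankOneLinkX8`): unpack conjuncts 1, 2, 8 (Burungale–Kobayashi–Ota Cor. A.5 in the ♯/♭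
  reading, ty1 p532534/p533144 — PUB* flag `BKO24-CorA5-sharpflat-via-Spr12-7.19`; BCDT modularity;
  entire continuation) and GZK; on an X8 pair of analytic rank `1` discharge Cor. A.5's hypotheses —
  `3 ≠ 2`, good, `3 ∣ a_3` (class), the newform of level `N_W` (`exists_isNewformOf`) with `3 ∤ N`
  (`not_dvd_level_of_isNewformOf`), its Sprung pair (Sprung 2017 Thm. 1.12, tree THEOREM
  `thm112_exists_isSprungPair_holds`), an admissible colour `L^• ≠ 0` (Sprung 2012 Prop. 6.14, tree
  THEOREM `IsSprungPair.exists_chromaticL_ne_zero`) — and apply ty1's reading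
  `missingPPartAt_of_corA5_sharpFlat`. Self-contained (does not wait for `PrintX8SharpFlatLinks.lean`).
* `glueRankZeroLinkX8_holds : GlueRankZeroLinkX8` (`PublishedInputsX8 → RankEqAnalyticRankLeOne →
  SharpFlatRankZeroLinkX8`): unpack conjuncts 2, 3, 4, 6, 7, 8 and GZK and apply p1's image-free
  rank-zero road `X8MainConjectureRoad.X8.missingPPartAt_of_sprungSharpFlatMainConjecture_of_analyticRank_eq_zero`
  (p533869: Sprung 2024 §5.2 in the kernel, no Kato / no `Surj W 3`). (Conjunct 4, Thm. 7.14, is not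
  even needed: `…_eq_zero'` of p535943; the unprimed road is used to match the item's wording.)
* `publishedInputsX8OfParts_holds : PublishedInputsX8OfParts` — the anonymous constructor.

References: route file `Theses/PrintX8.lean` rev 4 (items 20403/20408/20409/20416);
[BurungaleKobayashiOta2023] App. A Cor. A.5; [Sprung2012] Thm. 2.2, Prop. 6.14, Thm. 7.14, Main Conj.
7.21; [Sprung2017] Thm. 1.12; [Sprung2024] §5.2; [Miller2011LMS] Def. 1.1.
-/

set_option autoImplicit false
-- justification: the mandated namespace `Summit.BirchSwinnertonDyer.BirchSwinnertonDyer.Theorems`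
-- (single-conjunct summit, Sub = Summit) repeats a segment by design (D-0017).
set_option linter.dupNamespace false

noncomputable section

namespace Summit.BirchSwinnertonDyer.BirchSwinnertonDyer.Theorems.PrintX8Glue

open scoped Classical NumberField MatrixGroups ModularForm
open NumberField IsDedekindDomain WeierstrassCurve CongruenceSubgroup
  Literature.NumberTheory.EllipticCurves Literature.NumberTheory.EllipticCurves.ModularForms
  Literature.NumberTheory.EllipticCurves.Rank1Residual
  Literature.NumberTheory.EllipticCurves.Rank1Residual.Typed
  Literature.NumberTheory.EllipticCurves.Sprung2017 Literature.NumberTheory.EllipticCurves.Sprung2012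
  Literature.NumberTheory.EllipticCurves.Sprung2024
  Literature.NumberTheory.EllipticCurves.BurungaleKobayashiOta2024
  Summit.BirchSwinnertonDyer.BirchSwinnertonDyer.Theses.PrintX8
  Summit.BirchSwinnertonDyer.BirchSwinnertonDyer.Theorems.X8MainConjectureRoad

/-- **Route `PrintX8`, item stmt-BirchSwinnertonDyer-20408 `GlueRankOneLinkX8` PROVED**:
`PublishedInputsX8 → RankEqAnalyticRankLeOne → SharpFlatRankOneLinkX8`. Conjuncts used: 1 (the ♯/♭
reading of Burungale–Kobayashi–Ota Cor. A.5, PUB* flag `BKO24-CorA5-sharpflat-via-Spr12-7.19`), 2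
(BCDT `exists_isNewformOf`), 8 (`hasEntireLFunction_rat`), and GZK. On an X8 pair (`p = 3`, good
supersingular, `a_3 = ±3`) of analytic rank `1`, Cor. A.5's binders are discharged: `3 ≠ 2`, good
reduction and `3 ∣ a_3` from the class; the newform `f` of level `N_W` from BCDT with `3 ∤ N_W`
(`not_dvd_level_of_isNewformOf`); its Sprung pair by `thm112_exists_isSprungPair_holds` (Sprung 2017
Thm. 1.12); an admissible colour `L^• ≠ 0` by `IsSprungPair.exists_chromaticL_ne_zero` (Sprung 2012
Prop. 6.14); the main conjecture for that colour is the item's hypothesis `∀ •`. Conclusion by ty1's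
reading `missingPPartAt_of_corA5_sharpFlat`. [cite: BurungaleKobayashiOta2023, App. A Cor. A.5]
[cite: Sprung2012, Prop. 6.14 (p. 1498), Prop. 7.19 and Main Conj. 7.21 (p. 1505)] [cite: Sprung2017, Thm. 1.12]
[cite: Miller2011LMS, §1 and Def. 1.1] -/
theorem glueRankOneLinkX8_holds : GlueRankOneLinkX8 := by
  intro hPub hGZK W _ _ p _ hX h1 hMC
  obtain ⟨hA5, hmodf, -, -, -, -, -, hmod⟩ := hPub
  have hp3 : p = 3 := hX.1
  subst hp3
  have hgood : W.HasGoodReductionAtPrime 3 := hX.2.1.1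
  have hdvd : ((3 : ℕ) : ℤ) ∣ W.frobeniusTrace 3 := hX.2.1.2
  haveI : NeZero (W.conductorNorm ℤ) := ⟨(W.conductorNorm_pos_holds).ne'⟩
  obtain ⟨f, hf⟩ := hmodf W
  obtain ⟨Lsharp, Lflat, hSP⟩ :=
    thm112_exists_isSprungPair_holds (W := W) (f := f) (p := 3) (by decide) hf hgood hdvd
  obtain ⟨col, hcol⟩ := hSP.exists_chromaticL_ne_zero hf hgood
  exact missingPPartAt_of_corA5_sharpFlat W 3 hA5 hmod hGZK col (by decide) hgood hdvd h1 f
    (not_dvd_level_of_isNewformOf hf hgood) Lsharp Lflat hf hSP hcol (hMC col)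

/-- **Route `PrintX8`, item stmt-BirchSwinnertonDyer-20409 `GlueRankZeroLinkX8` PROVED**:
`PublishedInputsX8 → RankEqAnalyticRankLeOne → SharpFlatRankZeroLinkX8` — at EVERY X8 pair of
analytic rank `0`, any 3-adic image, any conductor. Conjuncts used: 2 (BCDT), 3 (Sprung 2012 Thm. 2.2,
Honda system), 4 (Thm. 7.14), 6 (Sprung 2024 Lemmas 5.5–5.9 all `N`, flag
`Sprung24-§5.2-allN-via-RaySprung25`), 7 (period unit at `3`), 8 (entire continuation), and GZK;
apply p1's image-free road `X8.missingPPartAt_of_sprungSharpFlatMainConjecture_of_analyticRank_eq_zero`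
(p533869: the main conjecture's equality `(gen) = (ϖ·L^•)` with `ϖ ∈ ℤ_3^×` replaces Kato's
divisibility, Lemma 5.9 gives `ord_3 gen(0)`, the unit interpolation constants give `ord_3 L^•(0)`).
[cite: Sprung2024, Thm. 5.3 (p. 38) and §5.2 (pp. 39–41)] [cite: Sprung2012, Thm. 2.2, Thm. 7.14 and Main Conj. 7.21]
[cite: Miller2011LMS, §1 and Def. 1.1] -/
theorem glueRankZeroLinkX8_holds : GlueRankZeroLinkX8 := by
  intro hPub hGZK W _ _ p _ hX h0 hMC
  obtain ⟨-, hmodf, h22, h714, -, h59, h3, hmod⟩ := hPub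
  exact X8.missingPPartAt_of_sprungSharpFlatMainConjecture_of_analyticRank_eq_zero hmodf h22 h714 h59 h3
    hGZK hmod W p hX h0 hMC

/-- **Route `PrintX8`, item stmt-BirchSwinnertonDyer-20416 `PublishedInputsX8OfParts` PROVED**: the
eight held published inputs BY NAME ⟹ their conjunction `PublishedInputsX8` (anonymous constructor;
the `PrintX6` / `SignedLowerHalves` OfParts idiom). [cite: Miller2011LMS, Def. 1.1] -/
theorem publishedInputsX8OfParts_holds : PublishedInputsX8OfParts :=
  fun h1 h2 h3 h4 h5 h6 h7 h8 => ⟨h1, h2, h3, h4, h5, h6, h7, h8⟩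

end Summit.BirchSwinnertonDyer.BirchSwinnertonDyer.Theorems.PrintX8Glue

end
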